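/-
Copyright (c) 2026 the pub-hodgecm-mathlib formalisation cell (harness21).  Prover seat hodgecm-mathlib-LH7-p07 (g0), Track A «(D-RAM) FOUR-FRAME» squad, helper lane on
h413 = stmt-HodgeConjecture-24833 (count-neutral).  β-BOARD v1 row R8 ∕ (Z₃), FILE 5d′ (LH7-p08 (g0) 21:55:19Z (3), dealt by name): «THE θ-VALUE OF ONE CORE-HANGING ORBIT» —
the twin of ★ 4c′ §1 with the collapsed read ★ 4a replaced by the CHARACTER read ★ 5a HEAD′ + ★ 5b + ★ 5b′, i.e. WITHOUT the near letter.  2026-09-04.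
-/
import Summits.HodgeConjecture.HodgeConjecture.Theorems.F0P3cDyRamLabelledOddCoreHangingCharacterWindows   -- ★ p862316 (LH7-p08, FILE 5b′): the three windows of `θ`; brings ★ 5b p862299 (`normSign_twoSlot_eq_reduced`, `theta_mul`), ★ 4a p861966
import Summits.HodgeConjecture.HodgeConjecture.Theorems.F0P3cDyRamLabelledOddCharacterSlotRead            -- ★ p862282 (LH7-p08, FILE 5a): `labelledOddCount_div_relIndex_eq_of_character`, `character_eq_one_of_label_invariant`
import Summits.HodgeConjecture.HodgeConjecture.Theorems.F0P3cDyRamLabelledOddCoreHangingBoundaryOrbit       -- ★ p862119 (LH7-p08, FILE 4c′): the orbit engine letters (★ (A) `exists_coreHanging_of_mem_orbit`, ★ (C) `finsum_stabiliserWeight_orbit_eq`)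
import Summits.HodgeConjecture.HodgeConjecture.Theorems.F0P3cDyRamLabelledOddCoreHangingClassSum          -- ★ (LH7-p08, FILE 2b): `valueClassLabel_mul_norm_iff_of_mem_unitStabilizer` (the label is `N′`-invariant)
import HarnessLib

/-!
# Crux `H413`, line LH4 «(D-RAM) FOUR-FRAME» — (β) table, β-BOARD row R8 ∕ (Z₃), FILE 5d′: «THE θ-VALUE OF ONE CORE-HANGING ORBIT» —
# `Σᶠ_{orbit of V_H(1,1,g)} m^Λ_i∕[𝒰:N′] = vec(g)_i∕2 · mass`, `vec(g) = (ω(g)·ε·ι, ε·ι, ω(−(1+g))·ε·J)`, `ε = ω(g·g_α + g_β)`, `ι = [2d−1 ≤ ρ]`, `J = [|ϖ|^ρ·|g_β − g_α| ≤ |ϖ|^{2d−1}·|g·g_α + g_β|]`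

Cell `hodgecm-mathlib` (D-0151), FLOOR 0, crux item H413 = `stmt-HodgeConjecture-24833`, route `HCCMUnconditional`; squad F0∕P3c∕LH4 (this seat re-dealt from F0∕P3c∕LH7).
THEOREMS ONLY (no `def`, no instance, no notation, no `sorry`, default heartbeats); ★-only imports; lane `--supports stmt-HodgeConjecture-24833 --as helper` (count-neutral);
pays NO row, states NO law.

WHY (LH7-p08 (g0), 2026-09-04 21:55:19Z (3), the `hZ₃` road 5a → 5b → 5b′ → 5d′ → 5d).  ★ 4c′ §1 `finsum_orbit_labelledOdd_div_relIndex_eq_of_near₃` evaluates the labelled-odd mass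
of one core-hanging orbit `𝒯·V_H(1,1,g)` under ★ 4a's COLLAPSED read, which needs the near letter `|ϖ|^ρ·|g_β − g_α| ≤ |ϖ|^{2d−1}·|G|` (`G = g·g_α + g_β`).  In the SHALLOW FAR range
that letter fails; there the (β) label on `S_F` of a member is still a CHARACTER label `Λ(D·u) ↔ ε·θ(u) = 1`, `ε = ω(G)`, `θ(u) = ω(G)·ω(L♭(u))`, `L♭(u) = (1+g)g_α·u₂ + (g_β − g_α)·u₁`
(★ FILE 2a read + ★ 5b bridge `normSign_twoSlot_eq_reduced`; `θ` multiplicative by ★ 5b `theta_mul`, trivial on `N′` because the label is `N′`-invariant, ★ 5a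
`character_eq_one_of_label_invariant`), so ★ 5a HEAD′ gives the per-lattice value `w∕2·ω(D_i)·ε·[ω_i·θ ≡ 1 on S_F]`, and ★ 5b′ evaluates the three brackets: slot 2 `= J`
(near: `forall_normSign_two_mul_theta_eq_one`; far — the complement of near, by discreteness of `|·|`: witness `exists_normSign_two_mul_theta_eq_neg_one`), slots 0∕1 `= ι`
(alive `2d−1 ≤ ρ`: `forall_normSign_mul_theta_eq_one_of_le`; dead: witnesses `exists_normSign_{one,zero}_mul_theta_eq_neg_one` under the two unit letters `|G + (g_β − g_α)| = |G|`,
`|G − g(g_β − g_α)| = |G|` of the keys of record).  The orbit engine is ★ 4c′ §1's VERBATIM (★ (A) every member is core-hanging with the exact invariant `g`, ★ (C) the mass).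
WHAT IS PROVED (letters of ★ 4c′ §1 with `hnear` DROPPED and `hb : |g_β − g_α| ≤ |G|`, `hGb : ρ ≤ 2d−2 → |G + (g_β − g_α)| = |G|`, `hGgb : ρ ≤ 2d−2 → |G − g·(g_β − g_α)| = |G|`
ADDED — the two unit letters are asked only in the dead window, LH7-p06 (g0) 21:57:12Z).
* §0 `far_of_not_near` — `¬(|ϖ|^ρ|b| ≤ |ϖ|^{2d−1}|G|) → |ϖ|^{2d−2}|G| ≤ |ϖ|^ρ|b|` (the value group is `ℤ`).
* §1 **`labelledOddCount_div_relIndex_coreHanging_eq_of_theta`** — the per-lattice CHARACTER read on a core-hanging member `latt(1 0 0; x ϖ^ρ 0; xζ+f·xζ ϖ^ρζ ϖ^{2ρ})`: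
  `m^Λ_i∕[𝒰:N′] = w∕2 · (ω(f), 1, ω(−(1+f)))_i · ω(G) · [∀ u ∈ S_F, ω(u_i)·ω(G)·ω(L♭(u)) = 1]` (★ 4a's letters with the collapse hypothesis replaced by `G ≠ 0`, `hdom`, `hb`).
* §2 **`labelledOddCount_div_relIndex_coreHanging_eq_of_windows`** — the brackets evaluated: `… = w∕2 · (ω(f)·ε·ι, ε·ι, ω(−(1+f))·ε·J)_i`.
* §3 **`finsum_orbit_labelledOdd_div_relIndex_eq_of_theta`** — THE HEAD: ★ 4c′ §1's statement with `hnear` dropped, `hb hGb hGgb` added, and the third entry `ω(−(1+g))·ε` ↦ `ω(−(1+g))·ε·J`.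
HONEST LABEL.  Count-neutral (`--supports`); pays no registered stub, touches no `Lines/` module, states no census law; the `hZ₃` head (5d), `hRest`, (β-BAL), (β), T₊ remain OPEN;
`HC_CM` is proved only modulo the 7 printed citations (2 remaining named inputs: hLiu418 = `stmt-HodgeConjecture-24832`, h413 = `stmt-HodgeConjecture-24833`) until rung 0 closes.

## References
* [Kottwitz1986BaseChangeUnits] R. E. Kottwitz, *Base change for unit elements of Hecke algebras*, Compositio Math. 60 (1986), §1 pp. 240–241 (signed lattice counts modulo the torus).
* [LanglandsShelstad1987] R. P. Langlands, D. Shelstad, *On the definition of transfer factors*, Math. Ann. 278 (1987), §3.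
* [Rogawski1990] J. D. Rogawski, *Automorphic Representations of Unitary Groups in Three Variables*, Ann. of Math. Stud. 123 (1990), §4.9 Prop. 4.9.1 (a)(b) p. 55, §4.10 p. 58.
* [Serre1979] J.-P. Serre, *Local Fields*, GTM 67 (1979), Ch. V §3 Cor. 3, Ch. XV §2.
-/

set_option autoImplicit false

noncomputable section

namespace Summit.HodgeConjecture.HodgeConjecture.Cruxes.H413.F0P3cDyRamLabelledOddCoreHangingOrbitTheta

open Matrix WithZero
open Literature.NumberTheory.Automorphic Literature.NumberTheory.Automorphic.HermitianLattice Literature.NumberTheory.Automorphic.UnitaryGroup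
open Literature.NumberTheory.Automorphic.UnitaryLatticeTree Literature.NumberTheory.Automorphic.UnitaryThreeFourFrame
open Literature.NumberTheory.LocalFields Literature.NumberTheory.LocalFields.WildQuadraticDatum
open Summit.HodgeConjecture.HodgeConjecture.Cruxes.H413.F0P3cDyRamFourFramePieces
open Summit.HodgeConjecture.HodgeConjecture.Cruxes.H413.F0P3cDyRamFourFrameCensusDefs
open Summit.HodgeConjecture.HodgeConjecture.Cruxes.H413.F0P3cDyRamStageOneBDefs
open Summit.HodgeConjecture.HodgeConjecture.Cruxes.H413.F0P3cDyRamDiagonalTorusDefs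
open Summit.HodgeConjecture.HodgeConjecture.Cruxes.H413.F0P3cDyRamDiagonalStrataDefs
open Summit.HodgeConjecture.HodgeConjecture.Cruxes.H413.F0P3cDyRamLabelledOddCountDefs
open Summit.HodgeConjecture.HodgeConjecture.Cruxes.H413.F0P3cDyRamTwoSlotLabelReadCoreHanging (valueClassLabel_latt_coreHanging_iff_normSign_linear)
open Summit.HodgeConjecture.HodgeConjecture.Cruxes.H413.F0P3cDyRamLabelledOddOneSlotRead (map_unitNormMap_unitStabilizer_le)
open Summit.HodgeConjecture.HodgeConjecture.Cruxes.H413.F0P3cDyRamLabelledOddCharacterSlotRead (labelledOddCount_div_relIndex_eq_of_character character_eq_one_of_label_invariant)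
open Summit.HodgeConjecture.HodgeConjecture.Cruxes.H413.F0P3cDyRamLabelledOddCoreHangingCharacterRead (normSign_twoSlot_eq_reduced theta_mul)
open Summit.HodgeConjecture.HodgeConjecture.Cruxes.H413.F0P3cDyRamLabelledOddCoreHangingCharacterWindows
open Summit.HodgeConjecture.HodgeConjecture.Cruxes.H413.F0P3cDyRamLabelledOddCoreHangingClassSum (valueClassLabel_mul_norm_iff_of_mem_unitStabilizer)
open Summit.HodgeConjecture.HodgeConjecture.Cruxes.H413.F0P3cDyRamDiagonalCoreHangingPolarisationExplicit (exists_explicit_polarisation_latt_hnf_coreHanging normSign_polarisation_coreHanging)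
open Summit.HodgeConjecture.HodgeConjecture.Cruxes.H413.F0P3cDyRamDiagonalOrbitFibreTransport (fibre_isCoset_zero)
open Summit.HodgeConjecture.HodgeConjecture.Cruxes.H413.F0P3cDyRamDiagonalOrbitFibreCountHeads (finite_unitTorus_orbit_of_mem_normalisedStableLattices)
open Summit.HodgeConjecture.HodgeConjecture.Cruxes.H413.F0P3cDyRamDiagonalCoreHangingCount (isNormalisedLattice_latt_coreHanging finsum_stabiliserWeight_orbit_eq)
open Summit.HodgeConjecture.HodgeConjecture.Cruxes.H413.F0P3cDyRamDiagonalCoreHangingOrbits (exists_coreHanging_of_mem_orbit)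
open Summit.HodgeConjecture.HodgeConjecture.Cruxes.H413.F0P3cDyRamDiagonalGluedTorusOrbits (exists_gl_coe_eq_glued)
open Summit.HodgeConjecture.HodgeConjecture.Cruxes.H413.F0P3cDyRamDiagonalGluedStabiliserIndex (ne_zero_and_v_lt_one_of_v_eq_exp)
open Summit.HodgeConjecture.HodgeConjecture.Cruxes.H413.F0P3cDyRamStableCountTypeZero (v_diag_eq_one diag_regular)
open Summit.HodgeConjecture.HodgeConjecture.Cruxes.H413.F0P3cDyRamDiagonalKappaSplitCountEval (normSign_mul_self)
open Summit.HodgeConjecture.HodgeConjecture.Cruxes.H413.F0P3cDyRamStableSumSignClasses (normSign_eq_one_or)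
open Summit.HodgeConjecture.HodgeConjecture.Cruxes.H413.F0P3cDyRamDiagonalKappaCoreHangingClass (two_le_d_of_v_two_lt_one)
open scoped Valued WithZero Matrix MatrixGroups

variable {K : Type} [Field K] [Valued K ℤᵐ⁰]

/-! ## §0  Near or far: the value group is `ℤ` -/

/-- **FAR IS THE COMPLEMENT OF NEAR**: if `|ϖ| = exp(−1)` and `¬ (|ϖ|^ρ·|b| ≤ |ϖ|^{2d−1}·|G|)` then `|ϖ|^{2d−2}·|G| ≤ |ϖ|^ρ·|b|` (all values are `0` or `exp` of an integer).
[cite: Serre1979, Ch. II §1] -/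
theorem far_of_not_near {ϖ b G : K} (hϖ : Valued.v ϖ = exp (-1 : ℤ)) {ρ d : ℕ}
    (h : ¬ Valued.v ϖ ^ ρ * Valued.v b ≤ Valued.v ϖ ^ (2 * d - 1) * Valued.v G) :
    Valued.v ϖ ^ (2 * d - 2) * Valued.v G ≤ Valued.v ϖ ^ ρ * Valued.v b := by
  have hb0 : Valued.v b ≠ 0 := fun h0 => h (by rw [h0, mul_zero]; exact zero_le)
  by_cases hG0 : Valued.v G = 0
  · rw [hG0, mul_zero]; exact zero_le
  rw [← exp_log hb0, ← exp_log hG0, hϖ, ← WithZero.exp_nsmul, ← WithZero.exp_nsmul, ← exp_add, ← exp_add, exp_le_exp] at h ⊢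
  simp only [nsmul_eq_mul, mul_neg, mul_one] at h ⊢
  omega

/-! ## §1  The per-lattice CHARACTER read on a core-hanging member -/

open Classical in
/-- **THE LABELLED-ODD VALUE OF A CORE-HANGING LATTICE AS A CHARACTER COUNT.**  Ramified datum (`|2| < 1`, complete, finite residue field), `ρ ≥ 1`; a member
`M = latt(1 0 0; x ϖ^ρ 0; xζ+f·xζ ϖ^ρζ ϖ^{2ρ})` of the core-hanging stratum (`x, ζ` units, `f` a fixed unit with `|1+f| = 1`), `T`-stable and normalised-stable, on the clean shell,
fixed approximants `g_α, g_β` (★ 4a's letters), and — in place of ★ 4a's collapse hypothesis — `G := f·g_α + g_β ≠ 0`, `|ϖ|^{2ρ}|g_α| ≤ |ϖ|^{2d−1}|G|`, `|g_β − g_α| ≤ |G|`.  Then for every slot `i`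
`labelledOddCount σ ϖ 0 i Λ M ∕ [𝒰 : N(S̃(M))] = stabiliserWeight σ M ∕ 2 · (ω(f), 1, ω(−(1+f)))_i · ω(G) · [∀ u ∈ S_F(M), ω(u_i)·(ω(G)·ω((1+f)g_α·u₂ + (g_β − g_α)·u₁)) = 1]`,
`Λ = valueClassLabel σ ϖ (α−1) (β−1) m* d`: the label of the class `D·u` is `[ω(G)·θ(u) = 1]`, `θ = ω(G)·ω(L♭)` (★ FILE 2a read, ★ 5b bridge), `θ` is a character of `S_F` trivial on `N′`
(★ 5b `theta_mul`; ★ 5a `character_eq_one_of_label_invariant` with ★ `valueClassLabel_mul_norm_iff_of_mem_unitStabilizer`), and ★ 5a HEAD′ counts.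
[cite: Kottwitz1986BaseChangeUnits, §1 pp. 240–241] [cite: LanglandsShelstad1987, §3] [cite: Rogawski1990, §4.9 Prop. 4.9.1 (a)(b) p. 55, §4.10 p. 58] -/
theorem labelledOddCount_div_relIndex_coreHanging_eq_of_theta [CompleteSpace K] [Finite 𝓀[K]] {σ : K →+* K} {ϖ : K} {d t : ℕ}
    (hD : IsRamifiedQuadraticDatum σ ϖ d t) (h2 : Valued.v (2 : K) < 1)
    {ρ : ℕ} (hρ : 1 ≤ ρ) {x ζ f : K} (hx : Valued.v x = 1) (hζ : Valued.v ζ = 1) (hσf : σ f = f) (hf : Valued.v f = 1) (h1f : Valued.v (1 + f) = 1)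
    (V : GL (Fin 3) K) (hV : (V : Matrix (Fin 3) (Fin 3) K) = !![1, 0, 0; x, ϖ ^ ρ, 0; x * ζ + f * (x * ζ), ϖ ^ ρ * ζ, ϖ ^ (2 * ρ)])
    {α β : K} {N₀ n₁ n₂ n₃ : ℕ} (hE : IsElementDatum σ ϖ N₀ α β n₁ n₂ n₃) {mc : ℕ} (hℓN : d % 2 + 1 ≤ N₀) (hmN : d % 2 + 2 * d - 1 ≤ N₀)
    (hℓmc : 2 * (d % 2) + 1 ≤ mc) (hmmc : d % 2 + 2 * d - 1 + d % 2 ≤ mc)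
    {T : GL (Fin 3) K} (hT : (T : Matrix (Fin 3) (Fin 3) K) = Matrix.diagonal ![α, β, 1]) (hM0 : latt (V : Matrix (Fin 3) (Fin 3) K) ∈ normalisedStableLattices T)
    (hlev : LatticeInLevel ϖ (d % 2) (Matrix.diagonal ![α - 1, β - 1, 0]) (latt (V : Matrix (Fin 3) (Fin 3) K)))
    (hnlev : ¬ LatticeInLevel ϖ (d % 2 + 1) (Matrix.diagonal ![α - 1, β - 1, 0]) (latt (V : Matrix (Fin 3) (Fin 3) K)))
    (hsq : LatticeInLevel ϖ mc (Matrix.diagonal ![(α - 1) * (α - 1), (β - 1) * (β - 1), 0]) (latt (V : Matrix (Fin 3) (Fin 3) K)))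
    {gα gβ : K} (hσgα : σ gα = gα) (hσgβ : σ gβ = gβ) (hG0 : f * gα + gβ ≠ 0)
    (hdom : Valued.v ϖ ^ (2 * ρ) * Valued.v gα ≤ Valued.v ϖ ^ (2 * d - 1) * Valued.v (f * gα + gβ))
    (hb : Valued.v (gβ - gα) ≤ Valued.v (f * gα + gβ))
    (hgα : Valued.v ((ϖ ^ (d % 2 + 2 * d - 1))⁻¹ * (((ϖ * σ ϖ) ^ ρ)⁻¹ * ((α - 1) - gα * ((ϖ - σ ϖ) * ((ϖ * σ ϖ) ^ ((d - d % 2) / 2))⁻¹)))) ≤ 1)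
    (hgβ : Valued.v ((ϖ ^ (d % 2 + 2 * d - 1))⁻¹ * (((ϖ * σ ϖ) ^ ρ)⁻¹ * ((β - 1) - gβ * ((ϖ - σ ϖ) * ((ϖ * σ ϖ) ^ ((d - d % 2) / 2))⁻¹)))) ≤ 1)
    (i : Fin 3) :
    (labelledOddCount σ ϖ 0 i (valueClassLabel σ ϖ (α - 1) (β - 1) (d % 2 + 2 * d - 1) d) (latt (V : Matrix (Fin 3) (Fin 3) K)) : ℚ) /
        ((((unitStabilizer (latt (V : Matrix (Fin 3) (Fin 3) K))).map (unitNormMap σ 3)).relIndex (fixedUnitTorus σ 3) : ℕ) : ℚ) =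
      stabiliserWeight σ (latt (V : Matrix (Fin 3) (Fin 3) K)) / 2 *
        ((((![normSign σ f, 1, normSign σ (-(1 + f))] : Fin 3 → ℤ) i * normSign σ (f * gα + gβ) *
          (if ∀ u ∈ fixedUnitStabilizer σ (latt (V : Matrix (Fin 3) (Fin 3) K)),
              normSign σ ((u i : Kˣ) : K) * (normSign σ (f * gα + gβ) * normSign σ ((1 + f) * gα * ((u 2 : Kˣ) : K) + (gβ - gα) * ((u 1 : Kˣ) : K))) = 1
            then 1 else 0) : ℤ)) : ℚ) := by
  have hTr := trace_bound_of_isRamifiedQuadraticDatum hD h2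
  obtain ⟨hσ, hvσ, hϖ, hfix, hdd, hd1, -⟩ := id hD
  haveI := isAdicComplete_valuedInteger_of_completeSpace hϖ
  have hϖ0 : ϖ ≠ 0 := fun h => by rw [h, map_zero] at hϖ; exact (exp_ne_zero hϖ.symm).elim
  have hϖ1 : Valued.v ϖ < 1 := by rw [hϖ, ← exp_zero, exp_lt_exp]; norm_num
  have hζ0 : ζ ≠ 0 := fun h => by rw [h, map_zero] at hζ; exact zero_ne_one hζ
  have hx0 : x ≠ 0 := fun h => by rw [h, map_zero] at hx; exact zero_ne_one hx
  have hf0 : f ≠ 0 := fun h => by rw [h, map_zero] at hf; exact zero_ne_one hf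
  have h1f0 : 1 + f ≠ 0 := fun h => by rw [h, map_zero] at h1f; exact zero_ne_one h1f
  -- the unit letters of the member
  have hy''1 : Valued.v (f * (x * ζ)) = 1 := by rw [map_mul, map_mul, hf, hx, hζ, one_mul, one_mul]
  have hy1 : Valued.v (x * ζ + f * (x * ζ)) = 1 := by
    rw [show x * ζ + f * (x * ζ) = x * ζ * (1 + f) by ring, map_mul, map_mul, hx, hζ, h1f, one_mul, one_mul]
  -- ★ κH (A1): the explicit polarisation with lineariser `f′ = f·Nζ`
  have hσf' : σ (f * (ζ * σ ζ)) = f * (ζ * σ ζ) := by rw [map_mul, map_mul, hσf, hσ, mul_comm (σ ζ) ζ]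
  have hR : Valued.v (ζ * σ (f * (x * ζ)) - σ x * (f * (ζ * σ ζ))) ≤ Valued.v ϖ ^ ρ := by
    rw [show ζ * σ (f * (x * ζ)) - σ x * (f * (ζ * σ ζ)) = 0 by rw [map_mul, map_mul, hσf]; ring, map_zero]; exact zero_le
  obtain ⟨D, ⟨hD1, hD2, hD0⟩, hDσ, hDV⟩ := exists_explicit_polarisation_latt_hnf_coreHanging hσ hvσ hϖ0 hϖ1 hTr ρ hρ hx hζ hy''1 hy1 V hV hσf' hR
  obtain ⟨hω1, hω2, hω0⟩ := normSign_polarisation_coreHanging σ hϖ0 ρ hx hζ hσf hf h1f hD1 hD2 hD0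
  -- `D₀ = D₁·N(x)·f`
  have hN0 : ζ * σ ζ ≠ 0 := mul_ne_zero hζ0 ((map_ne_zero σ).2 hζ0)
  have hσϖ0 : σ ϖ ≠ 0 := (map_ne_zero σ).2 hϖ0
  have hπ0 : ((ϖ * σ ϖ) ^ ρ : K) ≠ 0 := pow_ne_zero _ (mul_ne_zero hϖ0 hσϖ0)
  have hσζ0 : σ ζ ≠ 0 := (map_ne_zero σ).2 hζ0
  have hσx0 : σ x ≠ 0 := (map_ne_zero σ).2 hx0
  have hNf : ζ * σ ζ + f * (ζ * σ ζ) ≠ 0 := by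
    rw [show ζ * σ ζ + f * (ζ * σ ζ) = ζ * σ ζ * (1 + f) by ring]; exact mul_ne_zero hN0 h1f0
  have hD0' : D 0 = D 1 * (x * σ x) * f := by
    have hy : x * ζ + f * (x * ζ) = x * ζ * (1 + f) := by ring
    rw [hD0, hD1, hy, map_mul, map_mul, map_add, map_one, hσf]
    field_simp
    ring
  -- normalised; the type-0 fibre is one `S_F`-coset; the orbit is finite; the NI2 letters; `N′ ≤ S_F`
  have hnorm : IsNormalisedLattice (latt (V : Matrix (Fin 3) (Fin 3) K)) := by rw [hV]; exact isNormalisedLattice_latt_coreHanging hϖ1.le ρ hx hζ hy1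
  have hcoset : ∀ D' : Fin 3 → K, (∀ j, σ (D' j) = D' j ∧ D' j ≠ 0) →
      (IsVertexLattice σ ϖ (Matrix.diagonal D') 0 (latt (V : Matrix (Fin 3) (Fin 3) K)) ↔
        ∃ u ∈ fixedUnitStabilizer σ (latt (V : Matrix (Fin 3) (Fin 3) K)), ∀ j, D' j = D j * ((u j : Kˣ) : K)) :=
    fun D' hD' => fibre_isCoset_zero hvσ ϖ V rfl hnorm D hDσ hDV D' hD'
  have hfin := finite_unitTorus_orbit_of_mem_normalisedStableLattices hϖ (v_diag_eq_one hvσ hE) (diag_regular hE) T hT hM0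
  obtain ⟨c, hσc, hcv, hcn, hdich⟩ := exists_nonnorm_dichotomy_of_isRamifiedQuadraticDatum σ ϖ d t hD
  have hTM : mapGL T (latt (V : Matrix (Fin 3) (Fin 3) K)) = latt (V : Matrix (Fin 3) (Fin 3) K) := hM0.2.1
  have hNS : (unitStabilizer (latt (V : Matrix (Fin 3) (Fin 3) K))).map (unitNormMap σ 3) ≤ fixedUnitStabilizer σ (latt (V : Matrix (Fin 3) (Fin 3) K)) :=
    map_unitNormMap_unitStabilizer_le σ hσ ϖ 0 hDσ hDV hcoset
  -- the sign `ε = ω(G)` and the character `θ = ω(G)·ω(L♭)`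
  have hε : normSign σ (f * gα + gβ) = 1 ∨ normSign σ (f * gα + gβ) = -1 := normSign_eq_one_or σ _
  have hθmul : ∀ u ∈ fixedUnitStabilizer σ (latt (V : Matrix (Fin 3) (Fin 3) K)), ∀ u' ∈ fixedUnitStabilizer σ (latt (V : Matrix (Fin 3) (Fin 3) K)),
      (fun w : Fin 3 → Kˣ => normSign σ (f * gα + gβ) * normSign σ ((1 + f) * gα * ((w 2 : Kˣ) : K) + (gβ - gα) * ((w 1 : Kˣ) : K))) (u * u') =
        (fun w : Fin 3 → Kˣ => normSign σ (f * gα + gβ) * normSign σ ((1 + f) * gα * ((w 2 : Kˣ) : K) + (gβ - gα) * ((w 1 : Kˣ) : K))) u *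
          (fun w : Fin 3 → Kˣ => normSign σ (f * gα + gβ) * normSign σ ((1 + f) * gα * ((w 2 : Kˣ) : K) + (gβ - gα) * ((w 1 : Kˣ) : K))) u' :=
    fun u hu u' hu' => theta_mul hD hρ hx hζ hσf hf V hV hσgα hσgβ hG0 hdom hb hu hu'
  have hθ1 : ∀ u ∈ fixedUnitStabilizer σ (latt (V : Matrix (Fin 3) (Fin 3) K)),
      (fun w : Fin 3 → Kˣ => normSign σ (f * gα + gβ) * normSign σ ((1 + f) * gα * ((w 2 : Kˣ) : K) + (gβ - gα) * ((w 1 : Kˣ) : K))) u = 1 ∨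
        (fun w : Fin 3 → Kˣ => normSign σ (f * gα + gβ) * normSign σ ((1 + f) * gα * ((w 2 : Kˣ) : K) + (gβ - gα) * ((w 1 : Kˣ) : K))) u = -1 := by
    intro u _
    dsimp only
    rcases hε with h | h <;> rcases normSign_eq_one_or σ ((1 + f) * gα * ((u 2 : Kˣ) : K) + (gβ - gα) * ((u 1 : Kˣ) : K)) with h' | h' <;>
      rw [h, h'] <;> norm_num
  -- the label of the class `D·u` is `[ε·θ(u) = 1]` (★ FILE 2a read, ★ 5b bridge)
  have hΛ : ∀ u ∈ fixedUnitStabilizer σ (latt (V : Matrix (Fin 3) (Fin 3) K)),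
      valueClassLabel σ ϖ (α - 1) (β - 1) (d % 2 + 2 * d - 1) d (latt (V : Matrix (Fin 3) (Fin 3) K)) (fun j => D j * ((u j : Kˣ) : K)) ↔
        normSign σ (f * gα + gβ) *
            (fun w : Fin 3 → Kˣ => normSign σ (f * gα + gβ) * normSign σ ((1 + f) * gα * ((w 2 : Kˣ) : K) + (gβ - gα) * ((w 1 : Kˣ) : K))) u = 1 := by
    intro u hu
    have hufix : ∀ j, σ ((u j : Kˣ) : K) = u j := fun j => ((mem_fixedUnitTorus_iff σ u).1 hu.2).2 j
    have huv : ∀ j, Valued.v ((u j : Kˣ) : K) = 1 := fun j => ((mem_fixedUnitTorus_iff σ u).1 hu.2).1 j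
    have hDu : ∀ j, σ (D j * ((u j : Kˣ) : K)) = D j * ((u j : Kˣ) : K) ∧ D j * ((u j : Kˣ) : K) ≠ 0 := fun j =>
      ⟨by rw [map_mul, (hDσ j).1, hufix j], mul_ne_zero (hDσ j).2 (u j).ne_zero⟩
    have hMu : IsVertexLattice σ ϖ (Matrix.diagonal fun j => D j * ((u j : Kˣ) : K)) 0 (latt (V : Matrix (Fin 3) (Fin 3) K)) :=
      (hcoset _ hDu).2 ⟨u, hu, fun _ => rfl⟩
    -- the weights `D₀u₀ = π₀^{−ρ}·(N(x) f u₀)` and `D₁u₁N(x) = π₀^{−ρ}·(u₁ N(x))` are `π₀^{−ρ}` times units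
    have hwt0 : Valued.v (x * σ x * f * ((u 0 : Kˣ) : K)) ≤ 1 := by rw [map_mul, map_mul, map_mul, hx, hvσ, hx, hf, huv 0]; norm_num
    have hwt1 : Valued.v (((u 1 : Kˣ) : K) * (x * σ x)) ≤ 1 := by rw [map_mul, map_mul, huv 1, hx, hvσ, hx]; norm_num
    have hgαu : Valued.v ((ϖ ^ (d % 2 + 2 * d - 1))⁻¹ *
        (D 0 * ((u 0 : Kˣ) : K) * ((α - 1) - gα * ((ϖ - σ ϖ) * ((ϖ * σ ϖ) ^ ((d - d % 2) / 2))⁻¹)))) ≤ 1 := by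
      have e : (ϖ ^ (d % 2 + 2 * d - 1))⁻¹ * (D 0 * ((u 0 : Kˣ) : K) * ((α - 1) - gα * ((ϖ - σ ϖ) * ((ϖ * σ ϖ) ^ ((d - d % 2) / 2))⁻¹))) =
          (x * σ x * f * ((u 0 : Kˣ) : K)) * ((ϖ ^ (d % 2 + 2 * d - 1))⁻¹ * (((ϖ * σ ϖ) ^ ρ)⁻¹ * ((α - 1) - gα * ((ϖ - σ ϖ) * ((ϖ * σ ϖ) ^ ((d - d % 2) / 2))⁻¹)))) := by
        rw [hD0', hD1]; ring
      rw [e, map_mul]; exact mul_le_one' hwt0 hgα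
    have hgβu : Valued.v ((ϖ ^ (d % 2 + 2 * d - 1))⁻¹ *
        (D 1 * ((u 1 : Kˣ) : K) * (x * σ x) * ((β - 1) - gβ * ((ϖ - σ ϖ) * ((ϖ * σ ϖ) ^ ((d - d % 2) / 2))⁻¹)))) ≤ 1 := by
      have e : (ϖ ^ (d % 2 + 2 * d - 1))⁻¹ * (D 1 * ((u 1 : Kˣ) : K) * (x * σ x) * ((β - 1) - gβ * ((ϖ - σ ϖ) * ((ϖ * σ ϖ) ^ ((d - d % 2) / 2))⁻¹))) =
          (((u 1 : Kˣ) : K) * (x * σ x)) * ((ϖ ^ (d % 2 + 2 * d - 1))⁻¹ * (((ϖ * σ ϖ) ^ ρ)⁻¹ * ((β - 1) - gβ * ((ϖ - σ ϖ) * ((ϖ * σ ϖ) ^ ((d - d % 2) / 2))⁻¹)))) := by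
        rw [hD1]; ring
      rw [e, map_mul]; exact mul_le_one' hwt1 hgβ
    have hread := valueClassLabel_latt_coreHanging_iff_normSign_linear hD hρ hx hζ hy1 V hV (D := fun j => D j * ((u j : Kˣ) : K))
      (fun j => (hDu j).1) (fun j => (hDu j).2) hMu hE hℓN hmN hℓmc hmmc hlev hnlev hsq hT hTM hσgα hσgβ hgαu hgβu
    rw [hread]
    -- `D₀u₀·g_α + D₁u₁·N(x)·g_β = (D₁·N(x)) · (u₀ f g_α + u₁ g_β)`, `ω(D₁·N(x)) = 1`, and the ★ 5b bridge `ω(u₀ f g_α + u₁ g_β) = ω(L♭(u))`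
    have hfac : D 0 * ((u 0 : Kˣ) : K) * gα + D 1 * ((u 1 : Kˣ) : K) * (x * σ x) * gβ =
        (D 1 * (x * σ x)) * (((u 0 : Kˣ) : K) * f * gα + ((u 1 : Kˣ) : K) * gβ) := by rw [hD0']; ring
    have hσD1x : σ (D 1 * (x * σ x)) = D 1 * (x * σ x) := by rw [map_mul, (hDσ 1).1, map_mul, hσ, mul_comm (σ x) x]
    have hD1x0 : D 1 * (x * σ x) ≠ 0 := mul_ne_zero (hDσ 1).2 (mul_ne_zero hx0 ((map_ne_zero σ).2 hx0))
    have hωD1x : normSign σ (D 1 * (x * σ x)) = 1 := by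
      rw [normSign_mul_of_fixed hD (hDσ 1).1 (by rw [map_mul, hσ, mul_comm]) (hDσ 1).2 (mul_ne_zero hx0 ((map_ne_zero σ).2 hx0)), hω1, one_mul]
      exact normSign_of_isNorm σ ⟨x, rfl⟩
    have hS0 : σ (((u 0 : Kˣ) : K) * f * gα + ((u 1 : Kˣ) : K) * gβ) = ((u 0 : Kˣ) : K) * f * gα + ((u 1 : Kˣ) : K) * gβ := by
      rw [map_add, map_mul, map_mul, map_mul, hufix 0, hσf, hσgα, hufix 1, hσgβ]
    obtain ⟨hZ0, hZ⟩ := normSign_twoSlot_eq_reduced hD hρ hx hζ hσf hf V hV hσgα hσgβ hG0 hdom hb hu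
    rw [hfac, normSign_mul_of_fixed hD hσD1x hS0 hD1x0 hZ0, hωD1x, one_mul, hZ]
    dsimp only
    rw [← mul_assoc, normSign_mul_self, one_mul]
  -- `θ` is trivial on `N′` (the label is `N′`-invariant)
  have hθN : ∀ n ∈ (unitStabilizer (latt (V : Matrix (Fin 3) (Fin 3) K))).map (unitNormMap σ 3),
      (fun w : Fin 3 → Kˣ => normSign σ (f * gα + gβ) * normSign σ ((1 + f) * gα * ((w 2 : Kˣ) : K) + (gβ - gα) * ((w 1 : Kˣ) : K))) n = 1 :=
    character_eq_one_of_label_invariant hNS (valueClassLabel σ ϖ (α - 1) (β - 1) (d % 2 + 2 * d - 1) d) hε _ hθmul hθ1 hΛ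
      (fun n hn => valueClassLabel_mul_norm_iff_of_mem_unitStabilizer σ ϖ (α - 1) (β - 1) (d % 2 + 2 * d - 1) d hn D)
  -- ★ 5a HEAD′
  have hhead := labelledOddCount_div_relIndex_eq_of_character hσ hvσ hσc hcv hcn hdich hfin hDσ hDV hcoset
    (valueClassLabel σ ϖ (α - 1) (β - 1) (d % 2 + 2 * d - 1) d) i hε _ hθmul hθ1 hθN hΛ
  rw [hhead]
  -- the ω-table of `D`
  have hωD : normSign σ (D i) = (![normSign σ f, 1, normSign σ (-(1 + f))] : Fin 3 → ℤ) i := by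
    fin_cases i
    · exact hω0
    · exact hω1
    · exact hω2
  rw [hωD]
  push_cast
  ring

/-! ## §2  The three brackets evaluated (★ 5b′): slots 0∕1 `= [2d−1 ≤ ρ]`, slot 2 `= [|ϖ|^ρ|g_β − g_α| ≤ |ϖ|^{2d−1}|G|]` -/

/-- **THE LABELLED-ODD VALUE OF A CORE-HANGING LATTICE, ALL RANGES** (§1 with the brackets evaluated by ★ 5b′; the two unit letters `|G + (g_β − g_α)| = |G|`, `|G − f(g_β − g_α)| = |G|`,
asked only in the dead window `ρ ≤ 2d − 2`, feed the dead-window witnesses): `labelledOddCount σ ϖ 0 i Λ M ∕ [𝒰 : N(S̃(M))] = stabiliserWeight σ M ∕ 2 · (ω(f)·ε·ι, ε·ι, ω(−(1+f))·ε·J)_i`, `ε = ω(f·g_α + g_β)`, `ι = [2d−1 ≤ ρ]`,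
`J = [|ϖ|^ρ·|g_β − g_α| ≤ |ϖ|^{2d−1}·|f·g_α + g_β|]` (near: ★ `forall_normSign_two_mul_theta_eq_one`; far = not near (§0): ★ `exists_normSign_two_mul_theta_eq_neg_one`; alive: ★
`forall_normSign_mul_theta_eq_one_of_le`; dead: ★ `exists_normSign_{zero,one}_mul_theta_eq_neg_one`).
[cite: Kottwitz1986BaseChangeUnits, §1 pp. 240–241] [cite: LanglandsShelstad1987, §3] [cite: Rogawski1990, §4.9 Prop. 4.9.1 (a)(b) p. 55, §4.10 p. 58] -/
theorem labelledOddCount_div_relIndex_coreHanging_eq_of_windows [CompleteSpace K] [Finite 𝓀[K]] {σ : K →+* K} {ϖ : K} {d t : ℕ}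
    (hD : IsRamifiedQuadraticDatum σ ϖ d t) (h2 : Valued.v (2 : K) < 1)
    {ρ : ℕ} (hρ : 1 ≤ ρ) {x ζ f : K} (hx : Valued.v x = 1) (hζ : Valued.v ζ = 1) (hσf : σ f = f) (hf : Valued.v f = 1) (h1f : Valued.v (1 + f) = 1)
    (V : GL (Fin 3) K) (hV : (V : Matrix (Fin 3) (Fin 3) K) = !![1, 0, 0; x, ϖ ^ ρ, 0; x * ζ + f * (x * ζ), ϖ ^ ρ * ζ, ϖ ^ (2 * ρ)])
    {α β : K} {N₀ n₁ n₂ n₃ : ℕ} (hE : IsElementDatum σ ϖ N₀ α β n₁ n₂ n₃) {mc : ℕ} (hℓN : d % 2 + 1 ≤ N₀) (hmN : d % 2 + 2 * d - 1 ≤ N₀)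
    (hℓmc : 2 * (d % 2) + 1 ≤ mc) (hmmc : d % 2 + 2 * d - 1 + d % 2 ≤ mc)
    {T : GL (Fin 3) K} (hT : (T : Matrix (Fin 3) (Fin 3) K) = Matrix.diagonal ![α, β, 1]) (hM0 : latt (V : Matrix (Fin 3) (Fin 3) K) ∈ normalisedStableLattices T)
    (hlev : LatticeInLevel ϖ (d % 2) (Matrix.diagonal ![α - 1, β - 1, 0]) (latt (V : Matrix (Fin 3) (Fin 3) K)))
    (hnlev : ¬ LatticeInLevel ϖ (d % 2 + 1) (Matrix.diagonal ![α - 1, β - 1, 0]) (latt (V : Matrix (Fin 3) (Fin 3) K)))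
    (hsq : LatticeInLevel ϖ mc (Matrix.diagonal ![(α - 1) * (α - 1), (β - 1) * (β - 1), 0]) (latt (V : Matrix (Fin 3) (Fin 3) K)))
    {gα gβ : K} (hσgα : σ gα = gα) (hσgβ : σ gβ = gβ) (hG0 : f * gα + gβ ≠ 0)
    (hdom : Valued.v ϖ ^ (2 * ρ) * Valued.v gα ≤ Valued.v ϖ ^ (2 * d - 1) * Valued.v (f * gα + gβ))
    (hb : Valued.v (gβ - gα) ≤ Valued.v (f * gα + gβ))
    (hGb : ρ ≤ 2 * d - 2 → Valued.v (f * gα + gβ + (gβ - gα)) = Valued.v (f * gα + gβ))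
    (hGfb : ρ ≤ 2 * d - 2 → Valued.v (f * gα + gβ - f * (gβ - gα)) = Valued.v (f * gα + gβ))
    (hgα : Valued.v ((ϖ ^ (d % 2 + 2 * d - 1))⁻¹ * (((ϖ * σ ϖ) ^ ρ)⁻¹ * ((α - 1) - gα * ((ϖ - σ ϖ) * ((ϖ * σ ϖ) ^ ((d - d % 2) / 2))⁻¹)))) ≤ 1)
    (hgβ : Valued.v ((ϖ ^ (d % 2 + 2 * d - 1))⁻¹ * (((ϖ * σ ϖ) ^ ρ)⁻¹ * ((β - 1) - gβ * ((ϖ - σ ϖ) * ((ϖ * σ ϖ) ^ ((d - d % 2) / 2))⁻¹)))) ≤ 1)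
    (i : Fin 3) :
    (labelledOddCount σ ϖ 0 i (valueClassLabel σ ϖ (α - 1) (β - 1) (d % 2 + 2 * d - 1) d) (latt (V : Matrix (Fin 3) (Fin 3) K)) : ℚ) /
        ((((unitStabilizer (latt (V : Matrix (Fin 3) (Fin 3) K))).map (unitNormMap σ 3)).relIndex (fixedUnitTorus σ 3) : ℕ) : ℚ) =
      stabiliserWeight σ (latt (V : Matrix (Fin 3) (Fin 3) K)) / 2 *
        (((![normSign σ f * normSign σ (f * gα + gβ) * (if 2 * d - 1 ≤ ρ then 1 else 0),
             normSign σ (f * gα + gβ) * (if 2 * d - 1 ≤ ρ then 1 else 0),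
             normSign σ (-(1 + f)) * normSign σ (f * gα + gβ) *
               (if Valued.v ϖ ^ ρ * Valued.v (gβ - gα) ≤ Valued.v ϖ ^ (2 * d - 1) * Valued.v (f * gα + gβ) then 1 else 0)] : Fin 3 → ℤ) i : ℤ) : ℚ) := by
  classical
  obtain ⟨-, -, hϖ, -, -, -, -⟩ := id hD
  rw [labelledOddCount_div_relIndex_coreHanging_eq_of_theta hD h2 hρ hx hζ hσf hf h1f V hV hE hℓN hmN hℓmc hmmc hT hM0 hlev hnlev hsq hσgα hσgβ hG0 hdom hb hgα hgβ i]
  -- slots 0 and 1: the alive ∕ dead window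
  have hB01 : ∀ k : Fin 3, k = 0 ∨ k = 1 →
      (if ∀ u ∈ fixedUnitStabilizer σ (latt (V : Matrix (Fin 3) (Fin 3) K)),
          normSign σ ((u k : Kˣ) : K) * (normSign σ (f * gα + gβ) * normSign σ ((1 + f) * gα * ((u 2 : Kˣ) : K) + (gβ - gα) * ((u 1 : Kˣ) : K))) = 1
        then (1 : ℤ) else 0) = if 2 * d - 1 ≤ ρ then 1 else 0 := by
    intro k hk
    by_cases hal : 2 * d - 1 ≤ ρ
    · rw [if_pos hal, if_pos (forall_normSign_mul_theta_eq_one_of_le hD hal hx hζ hσf hf V hV hσgα hσgβ hG0 hb k hk)]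
    · rw [if_neg hal, if_neg]
      have hdead : ρ ≤ 2 * d - 2 := by omega
      intro hall
      rcases hk with rfl | rfl
      · obtain ⟨u, hu, hne⟩ := exists_normSign_zero_mul_theta_eq_neg_one hD h2 hρ hdead hx hζ hσf hf V hV hσgα hσgβ hG0 hb (hGfb hdead)
        have h1 := hall u hu
        rw [h1] at hne
        norm_num at hne
      · obtain ⟨u, hu, hne⟩ := exists_normSign_one_mul_theta_eq_neg_one hD h2 hρ hdead hx hζ hσf hf V hV hσgα hσgβ hG0 hb (hGb hdead)
        have h1 := hall u hu
        rw [h1] at hne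
        norm_num at hne
  -- slot 2: near ∕ far
  have hB2 : (if ∀ u ∈ fixedUnitStabilizer σ (latt (V : Matrix (Fin 3) (Fin 3) K)),
          normSign σ ((u 2 : Kˣ) : K) * (normSign σ (f * gα + gβ) * normSign σ ((1 + f) * gα * ((u 2 : Kˣ) : K) + (gβ - gα) * ((u 1 : Kˣ) : K))) = 1
        then (1 : ℤ) else 0) =
      if Valued.v ϖ ^ ρ * Valued.v (gβ - gα) ≤ Valued.v ϖ ^ (2 * d - 1) * Valued.v (f * gα + gβ) then 1 else 0 := by
    by_cases hnear : Valued.v ϖ ^ ρ * Valued.v (gβ - gα) ≤ Valued.v ϖ ^ (2 * d - 1) * Valued.v (f * gα + gβ)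
    · rw [if_pos hnear, if_pos (forall_normSign_two_mul_theta_eq_one hD hx hζ hσf hf V hV hσgα hσgβ hG0 hnear)]
    · rw [if_neg hnear, if_neg]
      intro hall
      obtain ⟨u, hu, hne⟩ := exists_normSign_two_mul_theta_eq_neg_one hD h2 hρ hx hζ hσf hf V hV hσgα hσgβ hG0 (far_of_not_near hϖ hnear)
      have h1 := hall u hu
      rw [h1] at hne
      norm_num at hne
  obtain rfl | rfl | rfl : i = 0 ∨ i = 1 ∨ i = 2 := by fin_cases i <;> simp
  · rw [hB01 0 (Or.inl rfl)]; simp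
  · rw [hB01 1 (Or.inr rfl)]; simp
  · rw [hB2]; simp

/-! ## §3  HEAD — the labelled-odd mass of ONE core-hanging orbit, all ranges -/

/-- **THE θ-VALUE OF ONE CORE-HANGING ORBIT (★ 4c′ §1 WITHOUT THE NEAR LETTER).**  For a fixed unit `g` with `|1 + g| = 1`, every member of the unit-torus orbit of `V_H(1,1,g)` is a
core-hanging lattice with the EXACT invariant `g` (★ (A) `exists_coreHanging_of_mem_orbit`), so §2 gives its value `w(M)∕2·vec(g)_i` with
`vec(g) = (ω(g)·ε·ι, ε·ι, ω(−(1+g))·ε·J)`, `ε = ω(g·g_α + g_β)`, `ι = [2d−1 ≤ ρ]`, `J = [|ϖ|^ρ·|g_β − g_α| ≤ |ϖ|^{2d−1}·|g·g_α + g_β|]`, on the whole orbit, and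
`Σᶠ_{orbit} = vec(g)_i∕2 · Σᶠ_{orbit} w` (★ (C) `finsum_stabiliserWeight_orbit_eq`).  Letters: ★ 4c′ §1's with `hnear` dropped and `hb`, `hGb`, `hGgb` added.
[cite: Kottwitz1986BaseChangeUnits, §1 pp. 240–241] [cite: LanglandsShelstad1987, §3] [cite: Rogawski1990, §4.9 Prop. 4.9.1 (a)(b) p. 55, §4.10 p. 58] -/
theorem finsum_orbit_labelledOdd_div_relIndex_eq_of_theta [CompleteSpace K] [Finite 𝓀[K]] {σ : K →+* K} {ϖ : K} {d t : ℕ}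
    (hD : IsRamifiedQuadraticDatum σ ϖ d t) (h2 : Valued.v (2 : K) < 1) {ρ : ℕ} (hρ : 1 ≤ ρ)
    {g : K} (hσg : σ g = g) (hvg : Valued.v g = 1) (h1g : Valued.v (1 + g) = 1)
    {α β : K} {N₀ n₁ n₂ n₃ : ℕ} (hE : IsElementDatum σ ϖ N₀ α β n₁ n₂ n₃) {mc : ℕ} (hℓN : d % 2 + 1 ≤ N₀) (hmN : d % 2 + 2 * d - 1 ≤ N₀)
    (hℓmc : 2 * (d % 2) + 1 ≤ mc) (hmmc : d % 2 + 2 * d - 1 + d % 2 ≤ mc)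
    {T : GL (Fin 3) K} (hT : (T : Matrix (Fin 3) (Fin 3) K) = Matrix.diagonal ![α, β, 1])
    (horb : ∀ M ∈ {M : Submodule 𝒪[K] (Fin 3 → K) | ∃ u ∈ unitTorus K 3,
        M = mapGL (diagGLUnits u) (latt (!![1, 0, 0; 1, ϖ ^ ρ, 0; 1 * 1 + g, ϖ ^ ρ * 1, ϖ ^ (2 * ρ)] : Matrix (Fin 3) (Fin 3) K))},
      M ∈ normalisedStableLattices T ∧
        LatticeInLevel ϖ (d % 2) (Matrix.diagonal ![α - 1, β - 1, 0]) M ∧ ¬ LatticeInLevel ϖ (d % 2 + 1) (Matrix.diagonal ![α - 1, β - 1, 0]) M ∧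
          LatticeInLevel ϖ mc (Matrix.diagonal ![(α - 1) * (α - 1), (β - 1) * (β - 1), 0]) M)
    {gα gβ : K} (hσgα : σ gα = gα) (hσgβ : σ gβ = gβ) (hG0 : g * gα + gβ ≠ 0)
    (hdom : Valued.v ϖ ^ (2 * ρ) * Valued.v gα ≤ Valued.v ϖ ^ (2 * d - 1) * Valued.v (g * gα + gβ))
    (hb : Valued.v (gβ - gα) ≤ Valued.v (g * gα + gβ))
    (hGb : ρ ≤ 2 * d - 2 → Valued.v (g * gα + gβ + (gβ - gα)) = Valued.v (g * gα + gβ))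
    (hGgb : ρ ≤ 2 * d - 2 → Valued.v (g * gα + gβ - g * (gβ - gα)) = Valued.v (g * gα + gβ))
    (hgα : Valued.v ((ϖ ^ (d % 2 + 2 * d - 1))⁻¹ * (((ϖ * σ ϖ) ^ ρ)⁻¹ * ((α - 1) - gα * ((ϖ - σ ϖ) * ((ϖ * σ ϖ) ^ ((d - d % 2) / 2))⁻¹)))) ≤ 1)
    (hgβ : Valued.v ((ϖ ^ (d % 2 + 2 * d - 1))⁻¹ * (((ϖ * σ ϖ) ^ ρ)⁻¹ * ((β - 1) - gβ * ((ϖ - σ ϖ) * ((ϖ * σ ϖ) ^ ((d - d % 2) / 2))⁻¹)))) ≤ 1)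
    (i : Fin 3) :
    ∑ᶠ M ∈ {M : Submodule 𝒪[K] (Fin 3 → K) | ∃ u ∈ unitTorus K 3, M = mapGL (diagGLUnits u) (latt (!![1, 0, 0; 1, ϖ ^ ρ, 0; 1 * 1 + g, ϖ ^ ρ * 1, ϖ ^ (2 * ρ)] : Matrix (Fin 3) (Fin 3) K))},
        (labelledOddCount σ ϖ 0 i (valueClassLabel σ ϖ (α - 1) (β - 1) (d % 2 + 2 * d - 1) d) M : ℚ) /
          ((((unitStabilizer M).map (unitNormMap σ 3)).relIndex (fixedUnitTorus σ 3) : ℕ) : ℚ) =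
      ((((![normSign σ g * normSign σ (g * gα + gβ) * (if 2 * d - 1 ≤ ρ then 1 else 0),
           normSign σ (g * gα + gβ) * (if 2 * d - 1 ≤ ρ then 1 else 0),
           normSign σ (-(1 + g)) * normSign σ (g * gα + gβ) *
             (if Valued.v ϖ ^ ρ * Valued.v (gβ - gα) ≤ Valued.v ϖ ^ (2 * d - 1) * Valued.v (g * gα + gβ) then 1 else 0)] : Fin 3 → ℤ) i : ℤ)) : ℚ) / 2 *
        (((((Nat.card 𝓀[K] - 1) * Nat.card 𝓀[K] ^ (ρ - 1)) * ((Nat.card 𝓀[K] - 1) * Nat.card 𝓀[K] ^ (2 * ρ - 1)) : ℕ) : ℚ) *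
          ((((Nat.card 𝓀[K] - 1) * Nat.card 𝓀[K] ^ ((ρ + 1) / 2 - 1)) * ((Nat.card 𝓀[K] - 1) * Nat.card 𝓀[K] ^ (ρ - 1)) : ℕ) : ℚ)⁻¹) := by
  obtain ⟨hσ, hvσ, hϖ, hfix, hd, -, -⟩ := id hD
  obtain ⟨hϖ0, -⟩ := ne_zero_and_v_lt_one_of_v_eq_exp hϖ
  -- the value is constant on the orbit, by value (§2 on every member)
  have hconst : ∀ M ∈ {M : Submodule 𝒪[K] (Fin 3 → K) | ∃ u ∈ unitTorus K 3,
        M = mapGL (diagGLUnits u) (latt (!![1, 0, 0; 1, ϖ ^ ρ, 0; 1 * 1 + g, ϖ ^ ρ * 1, ϖ ^ (2 * ρ)] : Matrix (Fin 3) (Fin 3) K))},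
      (labelledOddCount σ ϖ 0 i (valueClassLabel σ ϖ (α - 1) (β - 1) (d % 2 + 2 * d - 1) d) M : ℚ) /
          ((((unitStabilizer M).map (unitNormMap σ 3)).relIndex (fixedUnitTorus σ 3) : ℕ) : ℚ) =
        ((((![normSign σ g * normSign σ (g * gα + gβ) * (if 2 * d - 1 ≤ ρ then 1 else 0),
           normSign σ (g * gα + gβ) * (if 2 * d - 1 ≤ ρ then 1 else 0),
           normSign σ (-(1 + g)) * normSign σ (g * gα + gβ) *
             (if Valued.v ϖ ^ ρ * Valued.v (gβ - gα) ≤ Valued.v ϖ ^ (2 * d - 1) * Valued.v (g * gα + gβ) then 1 else 0)] : Fin 3 → ℤ) i : ℤ)) : ℚ) / 2 *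
          stabiliserWeight σ M := by
    intro M hM
    obtain ⟨hM0, hlev, hnlev, hsq⟩ := horb M hM
    obtain ⟨u, hu, rfl⟩ := hM
    obtain ⟨V₀, hV₀⟩ := exists_gl_coe_eq_glued (1 : K) 1 g (pow_ne_zero ρ hϖ0) (pow_ne_zero (2 * ρ) hϖ0)
    obtain ⟨x', ζ', y₁, hx', hζ', -, -, hκ, hMe⟩ := exists_coreHanging_of_mem_orbit u hu hvg h1g (ϖ ^ ρ) (ϖ ^ (2 * ρ)) V₀ hV₀
    have hx0 : x' ≠ 0 := fun h0 => by rw [h0, map_zero] at hx'; exact zero_ne_one hx'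
    have hζ0 : ζ' ≠ 0 := fun h0 => by rw [h0, map_zero] at hζ'; exact zero_ne_one hζ'
    have hy₁ : y₁ = g * (x' * ζ') := by rw [← hκ]; field_simp
    obtain ⟨V, hV⟩ := exists_gl_coe_eq_glued x' ζ' (g * (x' * ζ')) (pow_ne_zero ρ hϖ0) (pow_ne_zero (2 * ρ) hϖ0)
    rw [← hV₀] at hM0 hlev hnlev hsq ⊢
    rw [hMe, hy₁, ← hV] at hM0 hlev hnlev hsq ⊢
    rw [labelledOddCount_div_relIndex_coreHanging_eq_of_windows hD h2 hρ hx' hζ' hσg hvg h1g V hV hE hℓN hmN hℓmc hmmc hT hM0 hlev hnlev hsq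
      hσgα hσgβ hG0 hdom hb hGb hGgb hgα hgβ i]
    ring
  rw [finsum_mem_congr rfl hconst, ← mul_finsum_mem, finsum_stabiliserWeight_orbit_eq hσ hvσ hfix hϖ hd hρ hσg hvg]

end Summit.HodgeConjecture.HodgeConjecture.Cruxes.H413.F0P3cDyRamLabelledOddCoreHangingOrbitTheta

end
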